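import Mathlib
import Literature.Computability.AlgebraicComplexity.OrbitClosure
import Summits.ValiantsHypothesis.ValiantsHypothesis.Theorems.BorderApolarityFixedWitnessObstructionQPKuratowskiSubmodule
import Summits.ValiantsHypothesis.ValiantsHypothesis.Theorems.BorderApolarityToricFixedPointsCellRetractionAux1

/-!
# Border apolarity, crux `ToricFixedPoints` — Kuratowski limits of degree-`k` forms and the `μ`-filtration (helper 2)

Route `ValiantsHypothesis/BorderApolarity`, crux item `stmt-ValiantsHypothesis-5779`, line
`bb-cell-state-polytope`, second helper file for stub `stub_cellRetraction`.

* Transport of the abstract Grassmannian facts of helper 1 (`cellRetraction_li_of_ls`,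
  `cr_ls_of_li`) to subspaces of the degree-`k` forms `Hom_k ⊆ ℂ[x_σ]` (`σ` finite) in the
  coefficient topology (`coeffVec`, product topology), along the coordinate map
  `f ↦ (coeff e f)_{|e| = k}` into the Euclidean space on the degree-`k` exponents (injective on
  `Hom_k`, onto, and a homeomorphism onto its image for sequences of degree-`k` forms):
  `cr_coeff_li_of_ls` ((Ls) + equal dimensions ⇒ (Li)) and `cellRetraction_coeff_ls_of_li`
  ((Li) + equal dimensions ⇒ (Ls)).
* The `μ`-filtration of a cocharacter `μ : σ → ℤ`: the pieces `S_{≥ν}` = forms all of whose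
  monomials `e` have `Finsupp.weight μ e ≥ ν` (as submodules, `cr_exists_filt`), the weight
  projections `π_ν = weightedHomogeneousComponent μ ν`, and the bookkeeping between them
  (`S_{≥ν} ⊓ ker π_ν = S_{≥ν+1}`, closedness of `S_{≥ν}`, continuity of `π_ν`, lowest forms,
  `D = Σ_ν π_ν D`).
-/

open Filter Module
open scoped Topology

namespace Summit.ValiantsHypothesis.ValiantsHypothesis.Theorems.BorderApolarityToricFixedPoints

/-! ## Degree-`k` forms: transport to the Euclidean coordinate space -/

section Transport

open MvPolynomial
open Literature.Computability.AlgebraicComplexity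
open Summit.ValiantsHypothesis.ValiantsHypothesis.Theorems.BorderApolarityFixedWitnessObstructionQP
  (mem_homogeneousSubmodule_of_tendsto exists_coeff_eq)

variable {σ : Type} (k : ℕ)

/-- The coordinate map `f ↦ (coeff e f)_{|e| = k}` into the Euclidean space on the degree-`k`
exponents, as a linear map. [folklore] -/
theorem cr_exists_coordMap :
    ∃ π : MvPolynomial σ ℂ →ₗ[ℂ] EuclideanSpace ℂ {e : σ →₀ ℕ // e.degree = k},
      ∀ f e, π f e = coeff e.1 f :=
  ⟨(WithLp.linearEquiv 2 ℂ ({e : σ →₀ ℕ // e.degree = k} → ℂ)).symm.toLinearMap ∘ₗ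
      LinearMap.pi fun e => lcoeff ℂ e.1, fun _ _ => rfl⟩

variable {k}
variable (π : MvPolynomial σ ℂ →ₗ[ℂ] EuclideanSpace ℂ {e : σ →₀ ℕ // e.degree = k})
  (hπ : ∀ f e, π f e = coeff e.1 f)
include hπ

/-- The coordinate map is injective on degree-`k` forms. [folklore] -/
theorem cr_coord_eq_zero {f : MvPolynomial σ ℂ} (hf : f ∈ homogeneousSubmodule σ ℂ k)
    (h0 : π f = 0) : f = 0 := by
  ext e
  rw [coeff_zero]
  by_cases he : e.degree = k
  · rw [← hπ f ⟨e, he⟩, h0]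
    rfl
  · exact ((mem_homogeneousSubmodule k f).1 hf).coeff_eq_zero he

/-- The coordinate map preserves the dimension of spaces of degree-`k` forms. [folklore] -/
theorem cr_finrank_map_coord (p : Submodule ℂ (MvPolynomial σ ℂ))
    (hp : p ≤ homogeneousSubmodule σ ℂ k) : finrank ℂ (p.map π) = finrank ℂ p := by
  rw [← LinearMap.range_domRestrict]
  apply LinearMap.finrank_range_of_inj
  intro x y hxy
  apply Subtype.ext
  have h := cr_coord_eq_zero π hπ (f := x.1 - y.1) (Submodule.sub_mem _ (hp x.2) (hp y.2))
    (by rw [map_sub, sub_eq_zero]; exact hxy)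
  exact sub_eq_zero.1 h

/-- The coordinate map is onto from the degree-`k` forms. [folklore] -/
theorem cr_exists_coord_eq [Fintype {e : σ →₀ ℕ // e.degree = k}]
    (x : EuclideanSpace ℂ {e : σ →₀ ℕ // e.degree = k}) :
    ∃ D : MvPolynomial σ ℂ, D ∈ homogeneousSubmodule σ ℂ k ∧ π D = x := by
  obtain ⟨D, hDhom, hDx⟩ := exists_coeff_eq k (fun e => x e)
  refine ⟨D, hDhom, ?_⟩
  ext e
  rw [hπ, hDx]

/-- For degree-`k` forms, coefficientwise convergence is convergence of the coordinate vectors in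
the Euclidean space on the degree-`k` exponents. [folklore] -/
theorem cr_tendsto_coord_iff {D : MvPolynomial σ ℂ} {Ds : ℕ → MvPolynomial σ ℂ}
    (hDs : ∀ t, Ds t ∈ homogeneousSubmodule σ ℂ k) (hD : D ∈ homogeneousSubmodule σ ℂ k) :
    Tendsto (fun t => coeffVec (Ds t)) atTop (𝓝 (coeffVec D)) ↔
      Tendsto (fun t => π (Ds t)) atTop (𝓝 (π D)) := by
  have hind : Topology.IsInducing
      (WithLp.ofLp : EuclideanSpace ℂ {e : σ →₀ ℕ // e.degree = k} → ({e : σ →₀ ℕ // e.degree = k} → ℂ)) :=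
    ⟨rfl⟩
  rw [hind.tendsto_nhds_iff, tendsto_pi_nhds, tendsto_pi_nhds]
  constructor
  · intro h e
    have h1 := h e.1
    simp only [coeffVec_apply] at h1
    simpa only [Function.comp_apply, hπ] using h1
  · intro h e
    by_cases he : e.degree = k
    · have h1 := h ⟨e, he⟩
      simp only [Function.comp_apply, hπ] at h1
      simpa only [coeffVec_apply] using h1
    · have h2 : (fun t => coeffVec (Ds t) e) = fun _ => 0 := funext fun t =>
        ((mem_homogeneousSubmodule k _).1 (hDs t)).coeff_eq_zero he
      rw [h2, coeffVec_apply, ((mem_homogeneousSubmodule k D).1 hD).coeff_eq_zero he]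
      exact tendsto_const_nhds

omit π hπ

/-- **(Ls) and equal dimensions give (Li), for planes of degree-`k` forms.**  In the coefficient
topology: if the `A t` and `L` are `r`-dimensional subspaces of the degree-`k` forms in finitely
many variables and `L` contains every subsequential limit of elements of the `A (φ t)`, then every
element of `L` is a limit of elements `D_t ∈ A t` (transport of `cellRetraction_li_of_ls` along the
coordinate map). [folklore] -/
theorem cr_coeff_li_of_ls [Finite σ] (r : ℕ) (A : ℕ → Submodule ℂ (MvPolynomial σ ℂ))
    (L : Submodule ℂ (MvPolynomial σ ℂ))
    (hA : ∀ t, A t ≤ homogeneousSubmodule σ ℂ k) (hL : L ≤ homogeneousSubmodule σ ℂ k)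
    (hd : ∀ t, finrank ℂ (A t) = r) (hLd : finrank ℂ L = r)
    (hLs : ∀ (D : MvPolynomial σ ℂ) (φ : ℕ → ℕ) (Ds : ℕ → MvPolynomial σ ℂ), StrictMono φ →
      (∀ t, Ds t ∈ A (φ t)) → Tendsto (fun t => coeffVec (Ds t)) atTop (𝓝 (coeffVec D)) →
        D ∈ L) :
    ∀ D ∈ L, ∃ Ds : ℕ → MvPolynomial σ ℂ, (∀ t, Ds t ∈ A t) ∧
      Tendsto (fun t => coeffVec (Ds t)) atTop (𝓝 (coeffVec D)) := by
  classical
  haveI : Fintype σ := Fintype.ofFinite σ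
  haveI : Fintype {e : σ →₀ ℕ // e.degree = k} :=
    Fintype.subtype ((Finset.univ : Finset σ).finsuppAntidiag k) fun e => by
      simp [Finset.mem_finsuppAntidiag, Finsupp.degree_eq_sum]
  obtain ⟨π, hπ⟩ := cr_exists_coordMap (σ := σ) k
  have hfin := cr_finrank_map_coord π hπ
  -- (Ls) in coordinates
  have hLsE : ∀ (x : EuclideanSpace ℂ {e : σ →₀ ℕ // e.degree = k}) (φ : ℕ → ℕ)
      (xs : ℕ → EuclideanSpace ℂ {e : σ →₀ ℕ // e.degree = k}), StrictMono φ →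
      (∀ t, xs t ∈ (A (φ t)).map π) → Tendsto xs atTop (𝓝 x) → x ∈ L.map π := by
    intro x φ xs hφ hxs hlim
    have hDs : ∀ t, ∃ D, D ∈ A (φ t) ∧ π D = xs t := fun t => Submodule.mem_map.1 (hxs t)
    choose Ds hDsA hDsπ using hDs
    obtain ⟨D, hDhom, hDx⟩ := cr_exists_coord_eq π hπ x
    have hlim' : Tendsto (fun t => coeffVec (Ds t)) atTop (𝓝 (coeffVec D)) := by
      rw [cr_tendsto_coord_iff π hπ (fun t => hA _ (hDsA t)) hDhom]
      simpa only [hDsπ, hDx] using hlim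
    exact Submodule.mem_map.2 ⟨D, hLs D φ Ds hφ hDsA hlim', hDx⟩
  have hLiE := cellRetraction_li_of_ls r (fun t => (A t).map π) (L.map π)
    (fun t => (hfin _ (hA t)).trans (hd t)) ((hfin L hL).trans hLd) hLsE
  intro D hD
  obtain ⟨xs, hxs, hlim⟩ := hLiE (π D) (Submodule.mem_map_of_mem hD)
  have hDs : ∀ t, ∃ D', D' ∈ A t ∧ π D' = xs t := fun t => Submodule.mem_map.1 (hxs t)
  choose Ds hDsA hDsπ using hDs
  refine ⟨Ds, hDsA, ?_⟩
  rw [cr_tendsto_coord_iff π hπ (fun t => hA _ (hDsA t)) (hL hD)]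
  simpa only [hDsπ] using hlim

/-- **(Li) and equal dimensions give (Ls), for planes of degree-`k` forms.**  In the coefficient
topology: if the `A t` and `L` are `r`-dimensional subspaces of the degree-`k` forms in finitely
many variables and every element of `L` is a limit of elements `D_t ∈ A t`, then `L` contains every
subsequential limit of elements of the `A (φ t)` (transport of `cr_ls_of_li` along the coordinate
map).  (Registered sub-goal of stub `stub_cellRetraction`, hence the closed `∀` form.) [folklore] -/
theorem cellRetraction_coeff_ls_of_li :
    ∀ {σ : Type} [Finite σ] (k r : ℕ) (A : ℕ → Submodule ℂ (MvPolynomial σ ℂ))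
      (L : Submodule ℂ (MvPolynomial σ ℂ)),
      (∀ t, A t ≤ MvPolynomial.homogeneousSubmodule σ ℂ k) →
      L ≤ MvPolynomial.homogeneousSubmodule σ ℂ k →
      (∀ t, Module.finrank ℂ ↥(A t) = r) → Module.finrank ℂ ↥L = r →
      (∀ D ∈ L, ∃ Ds : ℕ → MvPolynomial σ ℂ, (∀ t, Ds t ∈ A t) ∧
        Filter.Tendsto (fun t => coeffVec (Ds t)) Filter.atTop (nhds (coeffVec D))) →
      ∀ (D : MvPolynomial σ ℂ) (φ : ℕ → ℕ) (Ds : ℕ → MvPolynomial σ ℂ), StrictMono φ →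
        (∀ t, Ds t ∈ A (φ t)) →
        Filter.Tendsto (fun t => coeffVec (Ds t)) Filter.atTop (nhds (coeffVec D)) → D ∈ L := by
  intro σ _ k r A L hA hL hd hLd hLi
  classical
  haveI : Fintype σ := Fintype.ofFinite σ
  haveI : Fintype {e : σ →₀ ℕ // e.degree = k} :=
    Fintype.subtype ((Finset.univ : Finset σ).finsuppAntidiag k) fun e => by
      simp [Finset.mem_finsuppAntidiag, Finsupp.degree_eq_sum]
  obtain ⟨π, hπ⟩ := cr_exists_coordMap (σ := σ) k
  have hfin := cr_finrank_map_coord π hπ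
  -- (Li) in coordinates
  have hLiE : ∀ x ∈ L.map π, ∃ xs : ℕ → EuclideanSpace ℂ {e : σ →₀ ℕ // e.degree = k},
      (∀ t, xs t ∈ (A t).map π) ∧ Tendsto xs atTop (𝓝 x) := by
    intro x hx
    obtain ⟨D, hD, rfl⟩ := Submodule.mem_map.1 hx
    obtain ⟨Ds, hDs, hlim⟩ := hLi D hD
    exact ⟨fun t => π (Ds t), fun t => Submodule.mem_map_of_mem (hDs t),
      (cr_tendsto_coord_iff π hπ (fun t => hA _ (hDs t)) (hL hD)).1 hlim⟩
  have hLsE := cr_ls_of_li r (fun t => (A t).map π) (L.map π)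
    (fun t => (hfin _ (hA t)).trans (hd t)) ((hfin L hL).trans hLd) hLiE
  intro D φ Ds hφ hDs hlim
  have hDhom : D ∈ homogeneousSubmodule σ ℂ k :=
    mem_homogeneousSubmodule_of_tendsto k (fun t => hA _ (hDs t)) hlim
  have h1 : π D ∈ L.map π := hLsE (π D) φ (fun t => π (Ds t)) hφ
    (fun t => Submodule.mem_map_of_mem (hDs t))
    ((cr_tendsto_coord_iff π hπ (fun t => hA _ (hDs t)) hDhom).1 hlim)
  obtain ⟨D', hD'L, hD'π⟩ := Submodule.mem_map.1 h1
  have hDD' : D' = D := sub_eq_zero.1 (cr_coord_eq_zero π hπ (Submodule.sub_mem _ (hL hD'L) hDhom)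
    (by rw [map_sub, hD'π, sub_self]))
  exact hDD' ▸ hD'L

end Transport

/-! ## The `μ`-filtration and the graded pieces -/

section Weights

open MvPolynomial
open Literature.Computability.AlgebraicComplexity

variable {σ : Type*} (μ : σ → ℤ)

/-- The filtration pieces `S_{≥ν}` (forms all of whose monomials have `μ`-weight `≥ ν`) exist as
submodules (`MvPolynomial.restrictSupport`). [folklore] -/
theorem cr_exists_filt :
    ∃ S : ℤ → Submodule ℂ (MvPolynomial σ ℂ), ∀ (ν : ℤ) (D : MvPolynomial σ ℂ),
      D ∈ S ν ↔ ∀ e ∈ D.support, ν ≤ Finsupp.weight μ e :=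
  ⟨fun ν => restrictSupport ℂ {e : σ →₀ ℕ | ν ≤ Finsupp.weight μ e}, fun _ _ => by
    rw [mem_restrictSupport_iff]
    exact Iff.rfl⟩

variable {μ}
variable {S : ℤ → Submodule ℂ (MvPolynomial σ ℂ)}
  (hS : ∀ (ν : ℤ) (D : MvPolynomial σ ℂ), D ∈ S ν ↔ ∀ e ∈ D.support, ν ≤ Finsupp.weight μ e)
include hS

/-- `D ∈ S_{≥ν}` iff the coefficients of `D` at exponents of weight `< ν` vanish. [folklore] -/
theorem cr_mem_filt_iff_coeff {ν : ℤ} {D : MvPolynomial σ ℂ} :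
    D ∈ S ν ↔ ∀ e : σ →₀ ℕ, Finsupp.weight μ e < ν → coeff e D = 0 := by
  rw [hS]
  constructor
  · intro h e he
    by_contra hne
    exact absurd (h e (mem_support_iff.2 hne)) (not_le.2 he)
  · intro h e he
    by_contra hlt
    exact (mem_support_iff.1 he) (h e (not_le.1 hlt))

/-- `S_{≥ν} ∩ ker π_ν = S_{≥ν+1}`: the kernel of the weight-`ν` projection on the `ν`-th filtration
piece is the next piece (weights are integers). [folklore] -/
theorem cr_filt_inf_ker (ν : ℤ) :
    S ν ⊓ LinearMap.ker (weightedHomogeneousComponent μ ν) = S (ν + 1) := by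
  ext D
  simp only [Submodule.mem_inf, LinearMap.mem_ker, cr_mem_filt_iff_coeff hS]
  constructor
  · rintro ⟨h1, h2⟩ e he
    rcases lt_or_eq_of_le (Int.lt_add_one_iff.1 he) with h | h
    · exact h1 e h
    · have h3 := congr_arg (coeff e) h2
      rwa [coeff_weightedHomogeneousComponent, if_pos h, coeff_zero] at h3
  · intro h
    refine ⟨fun e he => h e (by omega), ?_⟩
    ext e
    rw [coeff_weightedHomogeneousComponent, coeff_zero]
    split_ifs with he
    · exact h e (by omega)
    · rfl

/-- The filtration pieces are closed in the coefficient topology. [folklore] -/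
theorem cr_mem_filt_of_tendsto {ν : ℤ} {D : MvPolynomial σ ℂ} {Ds : ℕ → MvPolynomial σ ℂ}
    (hDs : ∀ t, Ds t ∈ S ν) (hlim : Tendsto (fun t => coeffVec (Ds t)) atTop (𝓝 (coeffVec D))) :
    D ∈ S ν := by
  rw [cr_mem_filt_iff_coeff hS]
  intro e he
  have h1 : Tendsto (fun t => coeffVec (Ds t) e) atTop (𝓝 (coeffVec D e)) :=
    (continuous_apply e).continuousAt.tendsto.comp hlim
  have h2 : (fun t => coeffVec (Ds t) e) = fun _ => 0 :=
    funext fun t => (cr_mem_filt_iff_coeff hS).1 (hDs t) e he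
  rw [h2] at h1
  exact tendsto_nhds_unique h1 tendsto_const_nhds

/-- An element of `S_{≥ν}` has no components of weight `< ν`. [folklore] -/
theorem cr_comp_eq_zero_of_mem_filt {ν ν' : ℤ} {E : MvPolynomial σ ℂ} (hE : E ∈ S ν)
    (hν' : ν' < ν) : weightedHomogeneousComponent μ ν' E = 0 :=
  weightedHomogeneousComponent_eq_zero' ν' E fun d hd h => by
    have := (hS ν E).1 hE d hd
    omega

/-- A form with no components of weight `< ν` lies in `S_{≥ν}`. [folklore] -/
theorem cr_mem_filt_of_comp_eq_zero {ν : ℤ} {E : MvPolynomial σ ℂ}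
    (h : ∀ ν' : ℤ, ν' < ν → weightedHomogeneousComponent μ ν' E = 0) : E ∈ S ν := by
  rw [cr_mem_filt_iff_coeff hS]
  intro e he
  have h1 := congr_arg (coeff e) (h _ he)
  rwa [coeff_weightedHomogeneousComponent, if_pos rfl, coeff_zero] at h1

/-- The weight-`ν` component of any form lies in `S_{≥ν}`. [folklore] -/
theorem cr_comp_mem_filt (ν : ℤ) (D : MvPolynomial σ ℂ) :
    weightedHomogeneousComponent μ ν D ∈ S ν := by
  rw [cr_mem_filt_iff_coeff hS]
  intro e he
  rw [coeff_weightedHomogeneousComponent, if_neg he.ne]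

omit hS

/-- The weight projections are continuous in the coefficient topology. [folklore] -/
theorem cr_tendsto_coeffVec_comp (ν : ℤ) {D : MvPolynomial σ ℂ} {Ds : ℕ → MvPolynomial σ ℂ}
    (hlim : Tendsto (fun t => coeffVec (Ds t)) atTop (𝓝 (coeffVec D))) :
    Tendsto (fun t => coeffVec (weightedHomogeneousComponent μ ν (Ds t))) atTop
      (𝓝 (coeffVec (weightedHomogeneousComponent μ ν D))) := by
  rw [tendsto_pi_nhds] at hlim ⊢
  intro e
  by_cases he : Finsupp.weight μ e = ν
  · simpa only [coeffVec_apply, coeff_weightedHomogeneousComponent, if_pos he] using hlim e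
  · simp only [coeffVec_apply, coeff_weightedHomogeneousComponent, if_neg he]
    exact tendsto_const_nhds

/-- The weight projections preserve degree-`k` forms. [folklore] -/
theorem cr_comp_mem_homogeneousSubmodule (ν : ℤ) {k : ℕ} {D : MvPolynomial σ ℂ}
    (hD : D ∈ homogeneousSubmodule σ ℂ k) :
    weightedHomogeneousComponent μ ν D ∈ homogeneousSubmodule σ ℂ k := by
  rw [mem_homogeneousSubmodule] at hD ⊢
  intro d hd
  rw [coeff_weightedHomogeneousComponent] at hd
  split_ifs at hd with h
  · exact hD hd
  · exact absurd rfl hd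

/-- Every form is the (finite) sum of its weight components, over the weights of its monomials.
[folklore] -/
theorem cr_sum_comp [DecidableEq σ] (D : MvPolynomial σ ℂ) :
    ∑ ν ∈ D.support.image (Finsupp.weight μ), weightedHomogeneousComponent μ ν D = D := by
  conv_rhs => rw [← sum_weightedHomogeneousComponent μ D]
  refine (finsum_eq_sum_of_support_subset _ fun ν hν => ?_).symm
  rw [Finset.coe_image]
  by_contra h
  refine hν (weightedHomogeneousComponent_eq_zero' ν D fun d hd hdν => h ?_)
  exact ⟨d, hd, hdν⟩

/-- `coeffVec` of a finite sum. [folklore] -/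
theorem cr_coeffVec_sum {ι : Type*} (s : Finset ι) (f : ι → MvPolynomial σ ℂ) :
    coeffVec (∑ i ∈ s, f i) = ∑ i ∈ s, coeffVec (f i) := by
  funext e
  simp only [coeffVec_apply, coeff_sum, Finset.sum_apply]

end Weights


end Summit.ValiantsHypothesis.ValiantsHypothesis.Theorems.BorderApolarityToricFixedPoints
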